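/-
Copyright (c) 2026. All rights reserved.
Released under Apache 2.0 license as described in the file LICENSE.
Authors: abc-iut cell, seat abc-iut-L4-t14 (gen 3; instance of the uniformised objects of the geometric
`EA` at `X̃ = ℍ`, `N = SL(2, ℝ)`: the Riemann surfaces `ℍ/Λ` and the maps `[τ] ↦ [γ • τ]`).
-/
import Literature.AnabelianGeometry.AbsoluteAnabelian.ArchimedeanHolFieldFunctorGeometricQuotient
import Literature.AnabelianGeometry.AbsoluteAnabelian.UniformizedCoverLiftPSL2R
import Mathlib.Analysis.Complex.UpperHalfPlane.Manifold
import Mathlib.Analysis.Complex.UpperHalfPlane.ProperAction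
import HarnessLib

/-!
# `ℍ/Λ` as objects of `HolRS` and `[τ] ↦ [γ • τ]` as morphisms (uniformised objects of the geometric `EA`)

S. Mochizuki, *Topics in absolute anabelian geometry III*, Def 4.1 (i)/(iii) pp. 101–103 and the proof of
Prop 4.2 (i) p. 106 l. 14–19 (kurims manuscript `paper:url-5493eb38cbb7`; bib key
`MochizukiAbsTopIII2015`): the objects of `EA` "arise from elliptically admissible hyperbolic
orbicurves over a CAF", i.e. (for trivial orbi-structure) are the Riemann surfaces `ℍ/Λ` uniformised by
the upper half plane, and "the full subcategory of `EA` consisting of objects that map to `X` may … be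
identified with … `Loc_R(X)`".

This file instantiates abc-iut-L4-t14's `HolRS.ofQuotient` / `HolRS.quotientHom` / `HolRS.LocObj.toHolRS`
(`ArchimedeanHolFieldFunctorGeometricQuotient.lean`) at `X̃ = ℍ` (Mathlib's `UpperHalfPlane`, with its
charted-space / `C^ω` structure) and `N = SL(2, ℝ)` (Mathlib's Möbius action):

* `HolRS.upperHalfPlane : HolRS` — `ℍ` as a connected Riemann surface;
* `HolRS.contMDiff_sl_smul` — every `τ ↦ γ • τ`, `γ ∈ SL(2, ℝ)`, is of class `C^ω`
  (Mathlib `UpperHalfPlane.contMDiff_smul` for `GL(2, ℝ)⁺` through `SpecialLinearGroup.mapGL`);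
* `HolRS.fuchsianQuotient Λ : HolRS` — `ℍ/Λ` for a subgroup `Λ ≤ SL(2, ℝ)` acting freely and properly
  discontinuously (i.e. a torsion-free Fuchsian group with `-1 ∉ Λ`), `fuchsianQuotient_carrier`;
* `HolRS.fuchsianQuotientHom γ h : ℍ/Λ₁ ⟶ ℍ/Λ₂` for `γ Λ₁ γ⁻¹ ≤ Λ₂` of finite index in `Λ₂`,
  `fuchsianQuotientHom_toFun_mk` (`[τ] ↦ [γ • τ]`);
* `HolRS.fuchsianLocFunctor Γ hfin : LocObj Γ ⥤ HolRS` — the functor from the group model `Loc(SL(2,ℝ), Γ)`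
  (p432943) for `Γ ≤ SL(2, ℝ)` acting freely and properly discontinuously.

* **`HolRS.exists_sl_of_hom`** — FULLNESS UP TO SIGN, the seam with abc-iut-w5-d208's
  `UniformizedCoverLiftPSL2R.lean` (`UniformizedLift.exists_sl_lift`, Farkas–Kra IV.7.1): EVERY morphism
  `f : ℍ/Λ₁ ⟶ ℍ/Λ₂` of `HolRS` is `[τ] ↦ [γ • τ]` for some `γ ∈ SL(2, ℝ)` with `γ Λ₁ γ⁻¹ ≤ ±Λ₂`
  (`UniformizedLift.conj_mem_or_neg_mem_of_sl_lift`).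

SIGN CAVEAT (honest scope): the lift gives `γ Λ₁ γ⁻¹ ≤ ±Λ₂` only; the model `Loc(SL(2,ℝ), Γ)` asks
`γ Λ₁ γ⁻¹ ≤ Λ₂` — the exact ambient group of print's `Loc_R(X)` is `PSL₂(ℝ)` (⊔ its anti-holomorphic
coset), not constructed here.  MODEL ≠ reconstruction; campaign-L
support (GAP row G-L4t14-R1, junction J1); nothing here bears on [IUTchIII] Cor. 3.12; typed ≠ proved.
-/

set_option autoImplicit false

noncomputable section

open scoped Manifold ContDiff Topology UpperHalfPlane MatrixGroups
open _root_.MulAction _root_.CategoryTheory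

namespace Literature.AnabelianGeometry.AbsoluteAnabelian

namespace HolRS

/-- **The upper half plane `ℍ` as an object of `HolRS`** (Hausdorff, contractible hence connected,
charted over `ℂ` by the open embedding, `C^ω`). [cite: MochizukiAbsTopIII2015, Definition 4.1 (i) p.101] -/
abbrev upperHalfPlane : HolRS := ⟨ℍ⟩

/-- The carrier of `upperHalfPlane` is `ℍ`. [cite: MochizukiAbsTopIII2015, Definition 4.1 (i) p.101] -/
theorem upperHalfPlane_carrier : upperHalfPlane.carrier = ℍ := rfl

/-- **`SL(2, ℝ)` acts on `ℍ` by biholomorphisms**: `τ ↦ γ • τ` is `C^ω` (Möbius transformations; Mathlib's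
`UpperHalfPlane.contMDiff_smul` for the positive-determinant `GL(2, ℝ)`-action, through
`SpecialLinearGroup.mapGL`). [cite: MochizukiAbsTopIII2015, Definition 4.1 (i) p.101] -/
theorem contMDiff_sl_smul (γ : SL(2, ℝ)) :
    ContMDiff 𝓘(ℂ, ℂ) 𝓘(ℂ, ℂ) ω (fun τ : ℍ => γ • τ) := by
  have h : (fun τ : ℍ => γ • τ) =
      fun τ : ℍ => (Matrix.SpecialLinearGroup.mapGL ℝ γ : GL (Fin 2) ℝ) • τ := by
    funext τ
    exact MulAction.compHom_smul_def _ γ τ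
  rw [h]
  exact UpperHalfPlane.contMDiff_smul (by simp)

/-- The same, phrased on the carrier of `upperHalfPlane`. [cite: MochizukiAbsTopIII2015, Definition 4.1 (i) p.101] -/
theorem contMDiff_sl_smul_carrier (γ : SL(2, ℝ)) :
    ContMDiff 𝓘(ℂ, ℂ) 𝓘(ℂ, ℂ) ω (fun τ : upperHalfPlane.carrier => γ • τ) :=
  contMDiff_sl_smul γ

/-- **The Riemann surface `ℍ/Λ`** for `Λ ≤ SL(2, ℝ)` acting freely and properly discontinuously on `ℍ`
(a torsion-free Fuchsian group not containing `-1`): an object of `HolRS`.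
[cite: MochizukiAbsTopIII2015, Definition 4.1 (i) p.101] -/
def fuchsianQuotient (Λ : Subgroup SL(2, ℝ)) [ProperlyDiscontinuousSMul Λ ℍ] [IsCancelSMul Λ ℍ] :
    HolRS :=
  ofQuotient upperHalfPlane Λ contMDiff_sl_smul_carrier

/-- The carrier of `ℍ/Λ` is the orbit space. [cite: MochizukiAbsTopIII2015, Definition 4.1 (i) p.101] -/
theorem fuchsianQuotient_carrier (Λ : Subgroup SL(2, ℝ)) [ProperlyDiscontinuousSMul Λ ℍ]
    [IsCancelSMul Λ ℍ] : (fuchsianQuotient Λ).carrier = orbitRel.Quotient Λ ℍ := rfl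

/-- **The morphism `[τ] ↦ [γ • τ] : ℍ/Λ₁ ⟶ ℍ/Λ₂`** for `γ Λ₁ γ⁻¹ ≤ Λ₂` of finite index in `Λ₂`.
[cite: MochizukiAbsTopIII2015, Definition 4.1 (iii) p.103] -/
def fuchsianQuotientHom (Λ₁ Λ₂ : Subgroup SL(2, ℝ)) [ProperlyDiscontinuousSMul Λ₁ ℍ] [IsCancelSMul Λ₁ ℍ]
    [ProperlyDiscontinuousSMul Λ₂ ℍ] [IsCancelSMul Λ₂ ℍ] (γ : SL(2, ℝ))
    (h : ∀ x ∈ Λ₁, γ * x * γ⁻¹ ∈ Λ₂)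
    [((Literature.Geometry.Manifold.QuotientManifold.conjSubgroup γ Λ₁).subgroupOf Λ₂).FiniteIndex] :
    fuchsianQuotient Λ₁ ⟶ fuchsianQuotient Λ₂ :=
  quotientHom upperHalfPlane Λ₁ Λ₂ contMDiff_sl_smul_carrier γ h

/-- Its underlying map: `[τ] ↦ [γ • τ]` — the shape of abc-iut-w5-d208's lifting conclusion
`π₂ (γ • τ) = h (π₁ τ)` with `π_i = Quotient.mk`. [cite: MochizukiAbsTopIII2015, Definition 4.1 (iii) p.103] -/
theorem fuchsianQuotientHom_toFun_mk (Λ₁ Λ₂ : Subgroup SL(2, ℝ)) [ProperlyDiscontinuousSMul Λ₁ ℍ]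
    [IsCancelSMul Λ₁ ℍ] [ProperlyDiscontinuousSMul Λ₂ ℍ] [IsCancelSMul Λ₂ ℍ] (γ : SL(2, ℝ))
    (h : ∀ x ∈ Λ₁, γ * x * γ⁻¹ ∈ Λ₂)
    [((Literature.Geometry.Manifold.QuotientManifold.conjSubgroup γ Λ₁).subgroupOf Λ₂).FiniteIndex]
    (τ : ℍ) :
    (fuchsianQuotientHom Λ₁ Λ₂ γ h).toFun (Quotient.mk _ τ) = Quotient.mk _ (γ • τ) := rfl

/-- **The functor `Loc(SL(2,ℝ), Γ) ⥤ HolRS`**, `Λ ↦ ℍ/Λ`, `[γ] ↦ ([τ] ↦ [γ • τ])`, for `Γ ≤ SL(2, ℝ)`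
acting freely and properly discontinuously, under the finite-fibre hypothesis `hfin` (automatic for
Fuchsian groups of finite covolume — not proved here). [cite: MochizukiAbsTopIII2015, Proposition 4.2 (i) proof p.106] -/
def fuchsianLocFunctor (Γ : Subgroup SL(2, ℝ)) [ProperlyDiscontinuousSMul Γ ℍ] [IsCancelSMul Γ ℍ]
    (hfin : ∀ (g : SL(2, ℝ)) (Λ₁ Λ₂ : LocObj Γ),
      (∀ x ∈ Λ₁.toSubgroup, g * x * g⁻¹ ∈ Λ₂.toSubgroup) →
      ((Literature.Geometry.Manifold.QuotientManifold.conjSubgroup g Λ₁.toSubgroup).subgroupOf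
        Λ₂.toSubgroup).FiniteIndex) :
    LocObj Γ ⥤ HolRS :=
  LocObj.toHolRS upperHalfPlane contMDiff_sl_smul_carrier Γ hfin

/-- On objects the functor is `Λ ↦ ℍ/Λ`. [cite: MochizukiAbsTopIII2015, Proposition 4.2 (i) proof p.106] -/
theorem fuchsianLocFunctor_obj_carrier (Γ : Subgroup SL(2, ℝ)) [ProperlyDiscontinuousSMul Γ ℍ]
    [IsCancelSMul Γ ℍ]
    (hfin : ∀ (g : SL(2, ℝ)) (Λ₁ Λ₂ : LocObj Γ),
      (∀ x ∈ Λ₁.toSubgroup, g * x * g⁻¹ ∈ Λ₂.toSubgroup) →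
      ((Literature.Geometry.Manifold.QuotientManifold.conjSubgroup g Λ₁.toSubgroup).subgroupOf
        Λ₂.toSubgroup).FiniteIndex) (Λ : LocObj Γ) :
    ((fuchsianLocFunctor Γ hfin).obj Λ).carrier = orbitRel.Quotient Λ.toSubgroup ℍ := rfl

/-! ### Fullness up to sign: every morphism `ℍ/Λ₁ ⟶ ℍ/Λ₂` is a Möbius map -/

/-- **Every morphism `ℍ/Λ₁ ⟶ ℍ/Λ₂` of `HolRS` is `[τ] ↦ [γ • τ]` for some `γ ∈ SL(2, ℝ)` with
`γ Λ₁ γ⁻¹ ≤ ±Λ₂`** — abc-iut-w5-d208's lifting theorem (`UniformizedLift.exists_sl_lift`, Farkas–Kra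
IV.7.1: the finite étale `f` is an unbranched holomorphic covering, `ℍ → ℍ/Λ_i` are holomorphic covering
maps) and `UniformizedLift.conj_mem_or_neg_mem_of_sl_lift`.  This is the fullness, up to the sign
ambiguity `±1 = ker (SL(2,ℝ) → Aut ℍ)`, of `Λ ↦ ℍ/Λ`, `γ ↦ ([τ] ↦ [γ • τ])` onto the morphisms of the
geometric `EA` between uniformised objects. [cite: MochizukiAbsTopIII2015, Proposition 4.2 (i) proof p.106] -/
theorem exists_sl_of_hom (Λ₁ Λ₂ : Subgroup SL(2, ℝ)) [ProperlyDiscontinuousSMul Λ₁ ℍ] [IsCancelSMul Λ₁ ℍ]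
    [ProperlyDiscontinuousSMul Λ₂ ℍ] [IsCancelSMul Λ₂ ℍ] (f : fuchsianQuotient Λ₁ ⟶ fuchsianQuotient Λ₂) :
    ∃ γ : SL(2, ℝ), (∀ τ : ℍ, f.toFun (Quotient.mk _ τ) = Quotient.mk _ (γ • τ)) ∧
      ∀ δ ∈ Λ₁, γ * δ * γ⁻¹ ∈ Λ₂ ∨ -(γ * δ * γ⁻¹) ∈ Λ₂ := by
  -- the two uniformisations
  let π₁ : ℍ → (fuchsianQuotient Λ₁).carrier := Quotient.mk (orbitRel Λ₁ ℍ)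
  let π₂ : ℍ → (fuchsianQuotient Λ₂).carrier := Quotient.mk (orbitRel Λ₂ ℍ)
  have hπ₁ : IsCoveringMap π₁ :=
    (isQuotientCoveringMap_quotientMk_of_properlyDiscontinuousSMul (G := Λ₁) (E := ℍ)).isCoveringMap
  have hπ₂ : IsCoveringMap π₂ :=
    (isQuotientCoveringMap_quotientMk_of_properlyDiscontinuousSMul (G := Λ₂) (E := ℍ)).isCoveringMap
  have dπ₁ : MDifferentiable 𝓘(ℂ, ℂ) 𝓘(ℂ, ℂ) π₁ :=
    (Literature.Geometry.Manifold.QuotientManifold.contMDiff_mk (G := Λ₁) (n := ω)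
      (fun k => contMDiff_sl_smul (k : SL(2, ℝ)))).mdifferentiable (by simp)
  have dπ₂ : MDifferentiable 𝓘(ℂ, ℂ) 𝓘(ℂ, ℂ) π₂ :=
    (Literature.Geometry.Manifold.QuotientManifold.contMDiff_mk (G := Λ₂) (n := ω)
      (fun k => contMDiff_sl_smul (k : SL(2, ℝ)))).mdifferentiable (by simp)
  -- base points
  obtain ⟨e₂, he₂⟩ := Quotient.exists_rep (f.toFun (π₁ UpperHalfPlane.I))
  have he : f.toFun (π₁ UpperHalfPlane.I) = π₂ e₂ := he₂.symm
  obtain ⟨γ, hγ, -⟩ := UniformizedLift.exists_sl_lift hπ₁ hπ₂ f.isFiniteEtale.isCoveringMap dπ₁ dπ₂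
    f.mdifferentiable he
  refine ⟨γ, fun τ => (hγ τ).symm, fun δ hδ => ?_⟩
  have hdeck : ∀ μ ∈ Λ₂, ∀ τ : ℍ, π₂ (μ • τ) = π₂ τ := fun μ hμ τ =>
    Quotient.sound ⟨⟨μ, hμ⟩, rfl⟩
  have horb : ∀ τ τ' : ℍ, π₂ τ = π₂ τ' → ∃ μ ∈ Λ₂, μ • τ = τ' := by
    intro τ τ' h
    obtain ⟨m, hm⟩ := Quotient.exact h
    refine ⟨((m⁻¹ : Λ₂) : SL(2, ℝ)), (m⁻¹).2, ?_⟩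
    rw [← hm]
    exact inv_smul_smul m τ'
  have hδ' : ∀ τ : ℍ, π₁ (δ • τ) = π₁ τ := fun τ => Quotient.sound ⟨⟨δ, hδ⟩, rfl⟩
  exact UniformizedLift.conj_mem_or_neg_mem_of_sl_lift hπ₂ Λ₂ hdeck horb hγ hδ'

end HolRS

end Literature.AnabelianGeometry.AbsoluteAnabelian

end
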